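import Summits.AtomisticToContinuum.HydrodynamicLimit.Theorems.InfluenceLocality.Negative.TubeEnclosure
import HarnessLib

/-!
# `InfluenceLocality` (stmt-AtomisticToContinuum-13916) — membership in the next tube (stub `stub_tubeNextPhase`)

Line `ignition-cascade-refutation` (lead c3), Phase 2 (construction of `IgnitionTemplates`). The phase sets of the
eventual phase script (Negative/PhaseScript.lean, `PhaseScript.TrackValid`) are time-windowed FREE-FLIGHT TUBES on
the flat torus `T3`: states `(t, x, v)` with `ts ≤ t`, `‖v - v₀‖ ≤ δv`, and whose back-extrapolation
`x + proj ((t₀ - t) • v)` to the nominal time `t₀` lies within `δx` (minimal-image distance `Torus.euclidDist`) of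
the nominal point `x₀`. This file discharges the membership half of the `post` field of `PhaseScript.TrackValid`:
right after a designed collision at a time `t` within `Δ` of the nominal event time `t⋆`, a particle whose position
is within `ρ` of the nominal event position `X` and whose new velocity is within `η` of the nominal post-event
velocity `V` lies in the NEXT tube `(ts', t⋆, X, V, δx', δv')`, provided `ts' ≤ t⋆ - Δ`, `η ≤ δv'` and
`ρ + Δ * (‖V‖ + η) ≤ δx'`. Design-independent; asserts no Theses decl.
-/

namespace Summit.AtomisticToContinuum.HydrodynamicLimit.Theorems.InfluenceLocality.Negative

open MeasureTheory Set
open scoped InnerProductSpace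
open Literature.Analysis.FluidPDE Literature.MathematicalPhysics.KineticTheory
open Literature.Analysis.FunctionSpaces

noncomputable section

/-- MEMBERSHIP IN THE NEXT TUBE. If `|t - t⋆| ≤ Δ`, `ts' ≤ t⋆ - Δ`, the position `x` is within `ρ` (minimal-image
distance) of `X`, and the velocity `v` is within `η` of `V` (`0 ≤ η`), then, as soon as `η ≤ δv'` and
`ρ + Δ * (‖V‖ + η) ≤ δx'`, the state `(t, x, v)` belongs to the tube `(ts', t⋆, X, V, δx', δv')`: `ts' ≤ t`,
`‖v - V‖ ≤ δv'`, and the back-extrapolated position `x + proj ((t⋆ - t) • v)` is within `δx'` of `X`.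
Proof: the first two are immediate; for the third, `Torus.euclidDist_translate_le x X ((t⋆ - t) • v) 0` gives
`euclidDist (x + proj ((t⋆ - t) • v)) X ≤ euclidDist x X + ‖(t⋆ - t) • v‖`, and
`‖(t⋆ - t) • v‖ = |t⋆ - t| * ‖v‖ ≤ Δ * (‖V‖ + η)` since `‖v‖ ≤ ‖V‖ + ‖v - V‖`. -/
theorem stub_tubeNextPhase :
    ∀ (ts' tstar t : ℝ) (X x : T3) (V v : V3) (Δ ρ η δx' δv' : ℝ),
    |t - tstar| ≤ Δ → ts' ≤ tstar - Δ → Torus.euclidDist x X ≤ ρ → ‖v - V‖ ≤ η → 0 ≤ η →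
    η ≤ δv' → ρ + Δ * (‖V‖ + η) ≤ δx' →
      ts' ≤ t ∧ ‖v - V‖ ≤ δv' ∧ Torus.euclidDist (x + Torus.proj ((tstar - t) • v)) X ≤ δx' := by
  intro ts' tstar t X x V v Δ ρ η δx' δv' ht hts hx hv _hη hδv hδx
  obtain ⟨ht₁, ht₂⟩ := abs_le.mp ht
  refine ⟨by linarith, hv.trans hδv, ?_⟩
  -- translate `x` by `(t⋆ - t) • v` and `X` by `0`
  have htr := Torus.euclidDist_translate_le x X ((tstar - t) • v) 0
  rw [Torus.proj_zero, add_zero, sub_zero] at htr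
  -- `‖v‖ ≤ ‖V‖ + η`
  have hvn : ‖v‖ ≤ ‖V‖ + η := by
    have := norm_le_norm_add_norm_sub' v V
    linarith
  -- `‖(t⋆ - t) • v‖ ≤ Δ * (‖V‖ + η)`
  have hnorm : ‖(tstar - t) • v‖ ≤ Δ * (‖V‖ + η) := by
    rw [norm_smul, Real.norm_eq_abs, abs_sub_comm]
    exact mul_le_mul ht hvn (norm_nonneg _) ((abs_nonneg _).trans ht)
  linarith

end

end Summit.AtomisticToContinuum.HydrodynamicLimit.Theorems.InfluenceLocality.Negative
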